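import Summits.BirchSwinnertonDyer.BirchSwinnertonDyer.Theses.ErratumRoadFive
import Literature.NumberTheory.EllipticCurves.Kato2004.AdmissibleZetaClassRealisability
import Literature.NumberTheory.EllipticCurves.Kato2004.AdmissibleZetaClassLengthInequality
import Literature.NumberTheory.EllipticCurves.Kato2004.IwasawaH2FineSelmerDualCountRankFree
import Literature.NumberTheory.EllipticCurves.MordellWeilTheoremProofs
import Literature.NumberTheory.EllipticCurves.TateModuleContinuityProofs
import Literature.NumberTheory.EllipticCurves.LeadingTerm
import Literature.NumberTheory.EllipticCurves.Rank1Residual.Typed.Basic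
import Literature.NumberTheory.EllipticCurves.CongruenceNumber
import Literature.NumberTheory.EllipticCurves.GrossZagierRationalPointProofs
import Literature.NumberTheory.EllipticCurves.Castella2018.PAdicWaldspurgerFormula
import Summits.BirchSwinnertonDyer.Rank1Residual.X11b.AnticyclotomicEmbedding
import Summits.BirchSwinnertonDyer.Rank1Residual.X11b.HalvesReceptacle
import Summits.BirchSwinnertonDyer.Rank1Residual.X11b.RouteR1BDPValue
import Literature.NumberTheory.EllipticCurves.ZpExtensionAnticyclotomicHoldsProofs
import Literature.NumberTheory.EllipticCurves.UnrIntegersUnits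
import Literature.NumberTheory.EllipticCurves.PastenSpectralDegreeProofs
import Literature.NumberTheory.EllipticCurves.NeronIsogenyScalingHoldsProofs
import Summits.BirchSwinnertonDyer.Rank1Residual.X11b.BDPRouteManin
import Literature.FieldTheory.AlgClosed.PadicAlgClEquivComplex
import Literature.NumberTheory.EllipticCurves.KrausOesterle1992.TorsionCongruenceCriterionHasseWeilProofs
import Summits.BirchSwinnertonDyer.BirchSwinnertonDyer.Theorems.CongruentShaFreeCutKatoKummerLogTorsion
import Literature.NumberTheory.QuadraticFields.ImaginaryResiduePiForm
import Summits.BirchSwinnertonDyer.BirchSwinnertonDyer.Theorems.ErratumRoadFiveGrossZagierDescentExact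
import Summits.BirchSwinnertonDyer.BirchSwinnertonDyer.Theorems.ErratumRoadFiveKatoFframeValueAtoms
import Summits.BirchSwinnertonDyer.BirchSwinnertonDyer.Theorems.ErratumRoadFiveKatoFframeValueAtomsOfFamily
import Summits.BirchSwinnertonDyer.BirchSwinnertonDyer.Theorems.ErratumRoadFiveValueByNormContinuity
import Literature.NumberTheory.EllipticCurves.BDPValueContinuityMultiplicativePrime
import Summits.BirchSwinnertonDyer.BirchSwinnertonDyer.Theorems.ErratumRoadFiveOpenInputNotRamBDPFrameDescentStub
import Literature.NumberTheory.EllipticCurves.StrictSelmerRankOneDegreeOneProofs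
import HarnessLib

/-!
# Deliverable 1 (BOARD INPUT #8, ADDENDUM 2; critic A202 gate (i)–(v)) — the BDV-calibration split of `A♭-fam`

Crux of record: `stmt-BirchSwinnertonDyer-19715`
(`Summit.BirchSwinnertonDyer.BirchSwinnertonDyer.Theses.ErratumRoadFive.EulerHalfNotRamNoInertSetAtFive`).
Ideator `bsd-idea-9` g48 (lens `complete`), 2026-08-30. W-71 / W-79: this file is a crux WORKFILE published with
`ledger crux write stmt-BirchSwinnertonDyer-19715 Lines/bdv_calibration_split.lean`; it registers nothing
(`ledger skeleton check` is NOT run on it), it opens no route, it proves no summit statement.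

## What this file does

It TYPES the split announced in `Ideas/bdv-integral-calibration.md` (rev 1.1, V354 PASS) and
`Lines/bdv22_R1_pnew_period.md` (rev 1.3) of the registered open stub

  `Summit.BirchSwinnertonDyer.BirchSwinnertonDyer.Cruxes.KatoValuationIneqNonsplitAtFive.BstwDoor.stub_katoBdpCrossingNonsplitFamily`
  (`Cruxes/KatoValuationIneqNonsplitAtFive/Lines/bstw_door.lean`, sha16 `5666110a8ff7d20b`, l.781–833; = door rev 3.9
  `Cruxes/EulerHalfNotRamNoInertSetAtFive/BstwZetaNonsplitDoorSketch.lean` l.761–813, `A♭-fam`)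

into two named statements and PROVES the recomposition:

* `BdvChainExplicitNonsplit` (S1, the pen's name) — **BDV22 (38) valued, up to its (K,p)-constant**: there is ONE
  function `V : ℕ → ℤ → ℤ` of `(p, d_L)` alone such that for EVERY `p`-non-exceptional rank-one curve
  (`NonExceptionalRankOneAt`: analytic rank 1, `E[p]` irreducible, and either non-split multiplicative or good
  ordinary at `p` — exactly the scope of [BDV22, §4, p. 35 «f is not p-exceptional»]), every admissible imaginary
  quadratic `L` and every value-pinned data tuple of the registered frame, the crossing norm identity holds with
  exponent `bdvExplicitExponent … − V p d_L`.  Its content is the UNIFORMITY of the one constant across curves AND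
  levels (BDV apply (38) with the same constant to forms of different level: the CM forms `θ_ψ` of level `D²`,
  [BDV22, Lemma 4.6 and (41)–(43), p. 44–45]) together with the valuation of every explicit row of the §4 constant
  ledger (`Lines/bdv22_sec4_constant_ledger.md` §2, rows 1–19; F1′).  It is implied by `A♭-fam ∧ (BSTW port)` (take
  `V = 0`) and implies neither.
* `EisensteinPeriodRatioValuation L p` (S2, the pen's name; = the R2 atom to be filed BY NAME as an ER5 aside) —
  **a calibrator exists at `(L, p)`**: some good-ordinary rank-one curve `E′` with surjective `ρ̄_{E′,p}`, Heegner for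
  `L`, non-vanishing twist, carrying a full value-pinned data tuple of the same frame with `σ′ ≠ 0`, satisfies the
  crossing norm identity with exponent `bdvExplicitExponent …` EXACTLY (no constant).  This is the conjunction of a
  SUPPLY statement (a suitable `E′` exists — conjecture-shaped, level-aspect non-vanishing / equidistribution of
  reduction types among rank-one curves; `CalibratorSupply`) and a PORT of print (Burungale–Skinner–Tian–Wan 2024,
  Thm. 1.13 = `thm:Kato-log` in its §6.2.1-integral form (log-Kato-elt-1) with `u_L ∈ ℤ_(p)^×` (86)–(94), p. 60, at a
  good ordinary prime, in the LEAD's Kato-family currency; `BstwIntegralPerrinRiouGoodOrdinary`) and of the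
  realisability of the data (`CalibratorDataRealisable`); the finer split is typed in §3 and recomposed by
  `eisensteinPeriodRatioValuation_of_supply_of_port`.
* `katoBdpCrossingNonsplitFamily_of_bdvChain_of_calibration : BdvChainExplicitNonsplit →
    (∀ p ≥ 5, ∀ admissible L, EisensteinPeriodRatioValuation L p) → A♭-fam` — PROVED (no `sorry`): the calibrator's
  exact identity and S1's identity at the calibrator are two powers of `p` with exponents `e′` and `e′ − V p d_L`,
  so `V p d_L = 0` (`zpow_right_injective₀`); S1 at the target curve then gives `A♭-fam`, the `a_p`-term of
  `bdvExplicitExponent` vanishing at a non-split multiplicative prime because `a_p = −1`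
  (`KrausOesterle1992.lFunction_apply_prime_eq_neg_one_of_not_split`) and `p ∤ p + 2` (`p ≥ 5`).
  Its conclusion is the registered stub statement TOKEN FOR TOKEN (gate (i)); since the farm does not build
  `Cruxes/**` modules as importable objects (`lean check` on an importing file answers
  `remote:stale:unbuilt:….Cruxes.KatoValuationIneqNonsplitAtFive.Lines.bstw_door`), the by-name `example` cannot be
  written here; instead `bottomClass` (§0) is the verbatim copy of `BstwDoor.bottomClass` (l.302–305 there) and the
  statement text l.782–832 there is reproduced byte-for-byte below (diff certificate in `Lines/bdv_calibration_split.md`).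

## Why S1 is not a costume (gate (ii))

`V` is bound ONCE, outside all curve data: S1 says the discrepancy between the true crossing exponent and the
explicit exponent is a function of `(p, d_L)` only, over the whole non-exceptional class.  Per single instance it
is nil (choose `V`); across two instances with the same `(p, d_L)` it is not; and it can only be USED through an
instance where the exponent is known exactly — the calibrator of S2, whose `∃`-data are pinned by VALUE equations to
named tree objects (`ZetaBody`, `IsNewformOf`, `IsBDPLFunction`, `UnrSeries.HasValueAt`, `HasLocPKummerLog`,
`heegnerPointComplex`, `plusPeriod`/`minusPeriod`/`realPeriodRat`/`imaginaryPeriodRat`) and carry `σ′ ≠ 0` as a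
conjunct (so the `(0 : ℚ_[p]).valuation = 0` junk of the g43 dead line cannot witness it).  The Skolemised variant
«`∃ V, chain(V) ∧ V p d_L = 0`» (⟺ `A♭-fam`, a costume) is NOT what is filed: `V p d_L = 0` is a CONSEQUENCE of S2,
proved in the glue, never an atom.

## Row table of `bdvExplicitExponent` (gate (iii); census = `Lines/bdv22_sec4_constant_ledger.md` §2, rows 1–19)

`bdvExplicitExponent p a_p c s k r_f m_f v_Kato = 1 − ord_p(p + 1 − a_p) + ord_p c − ord_p s − ord_p k − (ord_p r_f − ord_p m_f) − v_Kato`,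
read against the crossing identity hidden in `‖X‖` (door `bstwCrossing_of_normIdentity`:
`v + 1 + ord_p c + ord_p s + ord_p k + Γ₀ = 2·ord_p log_ω e(P_L)` at a non-split prime; here with the `a_p`-term):

| term of the exponent | census rows it collects | print locus | status |
|---|---|---|---|
| `v_Kato = v(σ) + ord_p(λ/(q·R⁻_𝟙·∏_{ℓ∣A,ℓ≠p} P_ℓ(1)))` | 1 (choice `Ω^± :=` Néron periods: binder `plusPeriod f = perRatio * W.realPeriodRat`), 2 (Kato's integral `_{c,d}z` vs `ζ^Kato_f`: the LEAD's family currency `ZetaBody`/`ratCuspFactor`/`eulerFactorAtOne`) | [Kato04 Thm 12.5 (1) p. 229; Thm 6.6] | EXPLICIT (value-pinned family; scale-invariant combination) |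
| `1 − ord_p(p + 1 − a_p)` (the `p`-LOCAL net) | BSTW/door side: Kato's dual-exponential factor and the BDP interpolation factor `(1 − a_p/p + 𝟙_{p∤N}/p)²` (`bdpInterpolationValue`, `ε_p`); BDV side: rows 3, 9, 13, 15, 18 (signed: (31) squared via Lemma 4.4, `E` once, `B` once — census §2 last paragraph), rows 5, 11 at their expected value `0` | [BSTW24 (log-Kato-elt-1) p. 60: `(1 − a_p(g)p⁻¹ + p⁻¹)²`, and `𝔅_p·(1−α_p⁻¹)⁻²` p. 59–60; BDP13 Thm 5.13; Castella18 Thm 2.11; BDV22 (31), L.4.4, L.4.5] | `= 1` at non-split multiplicative `p` (`a_p = −1`, this file's `bdvExplicitExponent_of_not_split`); `= 1 − a`, `a := ord_p(1 − a_p + p)`, at good `p`. **F1′(a)** := the claim that BDV's signed row total equals this net — recomputation from (28)–(38) OWED (census §2, «the research seat must recompute the signed sum»). |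
| `+ ord_p c`, `c = Dt.c` the MANIN constant (`φ^*ω_E = c·2πi f dz`, `ModularParametrizationData.c`) | 1 (conversion `log_{ω_f} ↔ log_{ω_E}` of the Heegner point) | [Mazur78 Cor 4.1 = tree `mazur_not_dvd_maninConstant_of_odd`; GrossZagier86 I.6] | EXPLICIT; `= 0` under the binder `¬ p ∣ Dt.c` (kept symbolic, as registered) |
| `− ord_p s − ord_p k` (Gross–Zagier descent scalars: `√|d_L|·L(E^{d_L},1) = s·Ω⁻_f`, `c·Ω⁻_f = k·Ω⁻_E`) | 18, second half («`L(f,ε_K,1)^{alg}` carried to `#Ш·Tam/…` by Gross–Zagier exactly as in the door's core») | [GrossZagier86 Thm I.6.3, V.2; tree `ErratumRoadFiveGrossZagierDescentExact`] | EXPLICIT |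
| `− (ord_p r_f − ord_p m_f)` =: `−Γ₀` | 6 (**R1′**: `ord_p Π̃_f(2) = ord_p m_f = ord_p deg φ` in NÉRON currency, `Lines/bdv22_R1_pnew_period.md` rev 1.3 §3–§4; present only because `f` is `p`-new) and 17-`ω_f` (**R3**: congruence number `r_f`) | [BDV22 Thm 3.1 value sentence p. 37 with BD14 (49) — memo O1 «λ-position»; Hida88 Thm 5.1 (5.6); arXiv:2312.16706 Thm 14; ARS12 Thm 2.1 = tree `padicValNat_congruenceNumber_eq_of_not_sq_dvd`; BSTW24 Prop 4.13 (ii) `c(ω,γ,γ′) ∈ O^×` p. 43 (the `p ∤ N` analogue)] | **F1′(b)** := the claim that rows 6 ∧ 17-`ω_f` net to `Γ₀` (each pays `deg φ` once in each direction; EXPECTED, not claimed, memo §4 item 2); `Γ₀ = 0` for `p² ∤ N` by ARS, kept symbolic as on the BSTW road.  The ONE transcription risk of this file: whether BSTW's good-`ω`/`O`-basis normalisation at a GOOD prime hides an extra `ord_p(α_p² − 1)` (relative congruence number of the `p`-stabilised form, memo §2 consistency check (i)); BSTW's displayed (log-Kato-elt-1) carries only `(1 − a_p/p + 1/p)²`,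 so none is transcribed into `bdvExplicitExponent`. |
| (absorbed in `V p d_L`) | 7, 8 (**R2** = `L(g)/log_p(u_p)`, `L(g) = Ω_{g,γ}/℧_{g,γ}`; BSTW's `u_L`), 12 (Katz/DLR constants), 17-`η_g` (non-Gorenstein Eisenstein denominator) — all `(K,p)`-ONLY; 10 (CM periods: exponent `4l − 4 = 0` at `l = 1`); 4, 14, 16 (`= 0` by the choice of BDV's auxiliary `c mod p ∉ {0, ±1}`); 19 (an equality of classes, no constant) | [BDV22 (38) and p. 44 L13–15: «depend on (K, p) but not on f»; (25) p. 34; Lemma 4.6 p. 44–45; BDPo22 = arXiv:1804.00648] | `(K,p)`-only or zero — exactly why S1 quantifies ONE `V` over `(p, d_L)` and why S2 (a calibrator) pins it |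

Named obligations of S1's PROOF ROAD (the BDV chain made integral) — not separately typable (their objects `BF_{K,1}`,
`Log_{g g*}`, `L_p(K,s)`, `Ω_{g,γ}`, `Π̃_f` are not tree objects), listed so each can be cited by name; loci in
`Lines/bdv22_R1_pnew_period.md` rev 1.3 §5 unless stated:
[obligation R1′] `ord_p Π̃_f(2) = ord_p deg φ_E` (Néron currency) for `f` weight 2, `p`-new, `p ≥ 5`, under (CR) — memo
§2 Routes A/B; [obligation F1′] = F1′(a) ∧ F1′(b) above (the signed totals); [obligation O1] BDV's analytic unit is
BD14's `C·η = 1/(λ⁺λ⁻EE*)` (`λ` downstairs; value sentence at `p ∤ cond(f)` correct; sign-relevant at `p`-new `k_o`: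
a `2·ord_p r_E` exponent error if read literally) and the FROZEN-`β` reading of (29) (BDV p. 37 L15, critic V354 P1:
one power of `EE*(f_{k_o})` between the two readings) — memo rev 1.3 §1–§3; [obligation c1] `Γ₁` vs `Γ₀` congruence
numbers (differ at `p` only if `p ∣ q − 1` for some `q ∣ M`); [obligation c2] étaleness of `𝕀` at `ν_o` (BDV's standing
`O(U_f)`); [obligation c3] identification «KLZ geometric `L_p(f,g)|_{l=1}` = Hida's `Φ/H` up to an explicit interpolable
factor»; [obligation c4] explicit ≠ unit: index factors `∏_{q∣M}(1 + 1/q)`, `φ`-values, `Γ₀/Γ₁` volume ratio can carry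
`p` when `q ≡ ±1 (mod p)`; [obligation c5] (CR) on the class: automatic from `Irr W p` of `ClassX11b`
(`Summits/BirchSwinnertonDyer/Rank1Residual/Partition/Rows.lean` l.117) at a multiplicative `p ≥ 3` (`p`-distinguished
is automatic), and from `Irr ∧ GoodOrd` at a good ordinary prime; [obligation c6] the MTT-side Euler factors at the
special point are verified by shape only (secondary source).  None of these is hidden in a `def` body: S1's body is
the exponent identity they are claimed to produce, with `V` absorbing exactly the `(K,p)`-only rows.

## Sources

[BDV22] Bertolini–Darmon–Venerucci, *Heegner points and Beilinson–Kato elements: a conjecture of Perrin-Riou*,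
Adv. Math. 398 (2022) 108172, doi:10.1016/j.aim.2022.108172 — §4 (38) p. 44, Lemma 4.6 p. 44–45, Thm 3.1 p. 36–37
(author pdf `paper:url-3ded9b2358bf`, acq-10507).  [BSTW24] Burungale–Skinner–Tian–Wan, *Zeta elements for elliptic
curves and applications*, arXiv:2409.01350 — Thm 1.13/`thm:Kato-log`, Thm 6.4 p. 59, §6.2.1 (86)–(94) p. 60, Prop.
4.13 p. 43.  [Kato04] Astérisque 295, Thm 12.5.  [BDP13] Duke 162, Thm 5.13.  [Castella18] Math. Ann. 370, Thm 2.11,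
Thm 3.2 (`Castella2018.thm32_exists_isBDPLFunction_valueAtOne`).  [ARS12] Agashe–Ribet–Stein, Thm 2.1
(`padicValNat_congruenceNumber_eq_of_not_sq_dvd`).  [KO92] Kraus–Oesterlé, Lemme 1 p. 262.
-/

noncomputable section

open scoped Classical NumberField TensorProduct BigOperators

set_option linter.dupNamespace false

namespace Summit.BirchSwinnertonDyer.BirchSwinnertonDyer.Cruxes.EulerHalfNotRamNoInertSetAtFive.BdvCalibrationSplit

open Field
open Literature.NumberTheory.GaloisRepresentations
open Literature.NumberTheory.EllipticCurves Literature.NumberTheory.EllipticCurves.Kato2004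
open Literature.NumberTheory.EllipticCurves.Kato2004.EulerSystemValues
open Literature.NumberTheory.EllipticCurves.Rank1Residual
open Literature.NumberTheory.EllipticCurves.Rank1Residual.Typed
open Literature.NumberTheory.EllipticCurves.ModularForms
open Literature.NumberTheory.EllipticCurves.Castella2018
open Summit.BirchSwinnertonDyer.Rank1Residual
open Summit.BirchSwinnertonDyer.BirchSwinnertonDyer.Theses.ErratumRoadFive
open Summit.BirchSwinnertonDyer.BirchSwinnertonDyer.Theorems
open IsDedekindDomain (HeightOneSpectrum)
open CongruenceSubgroup (Gamma0)

/-! ## §0 Vocabulary — verbatim copy of `BstwDoor.bottomClass` (bstw_door.lean l.302–305; body only, nothing asserted) -/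

/-- The BOTTOM LAYER `z_ℚ ∈ H¹(ℚ, T_pE)` of a class `z₀` of a pinned Iwasawa cohomology.
[cite: Kato2004Asterisque, §12.2 (p. 220) and §14.14 (14.14.1) (p. 243)] -/
def bottomClass (W : WeierstrassCurve ℚ) [W.IsElliptic] (p : ℕ) [Fact p.Prime]
    [ContinuousSMul ℤ_[p] (W.tateModule p)] (K : ZpExtension ℚ p) {γ : absoluteGaloisGroup ℚ}
    (I : IwasawaH1Data W p K γ) (z₀ : I.H) : H1 (tateRep W p) ⊤ :=
  layerZeroToTop W p K (I.proj 0 z₀)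

/-! ## §1 The class and the explicit exponent -/

/-- The `p`-NON-EXCEPTIONAL RANK-ONE class of [BDV22, §4]: analytic rank `1`, `E[p]` irreducible, and `p` either of
non-split multiplicative reduction or of good ordinary reduction («f is not p-exceptional», [BDV22, p. 7 L16–19 and
p. 35 L24–29]).  The non-split multiplicative members with `p ≠ 2` are exactly `ClassX11b ∧ ¬ split`
(`nonExceptionalRankOneAt_of_classX11b`). [cite: BertoliniDarmonVenerucci2022, §4, p. 35] -/
def NonExceptionalRankOneAt (W : WeierstrassCurve ℚ) [W.IsElliptic] [W.IsGloballyMinimal] (p : ℕ)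
    [Fact p.Prime] : Prop :=
  W.analyticRank = 1 ∧ Irr W p ∧
    ((Mult W p ∧ ¬ W.HasSplitMultiplicativeReductionAtPrime p) ∨ GoodOrd W p)

theorem nonExceptionalRankOneAt_of_classX11b (W : WeierstrassCurve ℚ) [W.IsElliptic] [W.IsGloballyMinimal]
    (p : ℕ) [Fact p.Prime] (hX : ClassX11b W p) (hns : ¬ W.HasSplitMultiplicativeReductionAtPrime p) :
    NonExceptionalRankOneAt W p :=
  ⟨hX.1, hX.2.2.2, Or.inl ⟨hX.2.2.1, hns⟩⟩

/-- The EXPLICIT crossing exponent of the BDV chain (row table in the module docstring):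
`1 − ord_p(p + 1 − a_p) + ord_p c − ord_p s − ord_p k − (ord_p r_f − ord_p m_f) − v_Kato`.
Arguments: `ap = a_p(E)` (`W.LFunction p`), `c` = the Manin constant of the parametrisation (`Dt.c`), `s`, `k` =
the two Gross–Zagier descent scalars, `rf` = congruence number, `m` = (minimal) modular degree, `v` = the Kato-family
normalisation valuation `v(σ) + ord_p(λ/(q·R·∏P_ℓ))`.
[cite: BertoliniDarmonVenerucci2022, §4 (38), p. 44] [cite: BurungaleSkinnerTianWan2024, §6.2.1 (log-Kato-elt-1), p. 60] -/
def bdvExplicitExponent (p : ℕ) (ap c : ℤ) (s : ℚ) (k : ℤ) (rf m : ℕ) (v : ℤ) : ℤ :=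
  1 - padicValInt p ((p : ℤ) + 1 - ap) + padicValInt p c - padicValRat p s - padicValInt p k -
    ((padicValNat p rf : ℤ) - padicValNat p m) - v

/-- At a prime `p ≥ 5` of NON-SPLIT multiplicative reduction `a_p = −1` [KO92, Lemme 1], so `p + 1 − a_p = p + 2`
is prime to `p` and the `a_p`-term of `bdvExplicitExponent` vanishes: the explicit exponent is the registered
`A♭-fam` exponent. [cite: KrausOesterle1992, §3 Lemme 1, p. 262] -/
theorem bdvExplicitExponent_of_not_split (W : WeierstrassCurve ℚ) [W.IsElliptic] (p : ℕ) [Fact p.Prime]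
    (hm : Mult W p) (hns : ¬ W.HasSplitMultiplicativeReductionAtPrime p) (h5 : 5 ≤ p)
    (c : ℤ) (s : ℚ) (k : ℤ) (rf m : ℕ) (v : ℤ) :
    bdvExplicitExponent p (W.LFunction p) c s k rf m v =
      1 + padicValInt p c - padicValRat p s - padicValInt p k - ((padicValNat p rf : ℤ) - padicValNat p m) - v := by
  have ha : W.LFunction p = -1 :=
    KrausOesterle1992.lFunction_apply_prime_eq_neg_one_of_not_split W p hm hns
  have h0 : padicValInt p ((p : ℤ) + 1 - W.LFunction p) = 0 := by
    rw [ha]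
    refine padicValInt.eq_zero_of_not_dvd ?_
    intro hdvd
    have h2 : (p : ℤ) ∣ ((2 : ℕ) : ℤ) := by
      have h' := dvd_sub hdvd (dvd_refl (p : ℤ))
      have e : (p : ℤ) + 1 - -1 - (p : ℤ) = ((2 : ℕ) : ℤ) := by push_cast; ring
      rwa [e] at h'
    have hp2 : p ∣ 2 := Int.natCast_dvd_natCast.mp h2
    have := Nat.le_of_dvd two_pos hp2
    omega
  rw [bdvExplicitExponent, h0]
  ring

/-! ## §2 The two pieces and the proved recomposition -/

/-- **S1 — `BdvChainExplicitNonsplit`: BDV22 (38) valued up to its `(K,p)`-constant.**  There is ONE function `V`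
of `(p, d_L)` such that on the whole `p`-non-exceptional rank-one class (non-split multiplicative OR good ordinary
`p ≥ 5`, `ρ̄_{E,p}` surjective), for every admissible imaginary quadratic `L` and every value-pinned data tuple of
the registered frame (binders of `BstwDoor.stub_katoBdpCrossingNonsplitFamily` from `∀ L` on, verbatim), the crossing
norm identity holds with exponent `bdvExplicitExponent … − V p d_L`.  Content: f- and N-blindness of the one constant
of [BDV22 (38)] («depend on (K,p) but not on f», p. 44 L13–15; applied across levels in Lemma 4.6) + the valued row
ledger (module docstring; F1′, R1′, obligations c1–c6).  Why it might fail: c1 (no integral Thm 3.1 in print) and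
the frozen-`β` discrepancy c3 at `p`-new weight.  Implied by `A♭-fam ∧ BstwIntegralPerrinRiouGoodOrdinary` (`V = 0`).
[cite: BertoliniDarmonVenerucci2022, §4 (38) and Lemma 4.6, p. 44–45] -/
def BdvChainExplicitNonsplit : Prop :=
  ∃ V : ℕ → ℤ → ℤ,
    ∀ (W : WeierstrassCurve ℚ) [W.IsElliptic] [W.IsGloballyMinimal] (p : ℕ) [Fact p.Prime]
      [ContinuousSMul ℤ_[p] (W.tateModule p)] [Module.Free ℤ_[p] (W.tateModule p)]
      [Module.Finite ℤ_[p] (W.tateModule p)] [NeZero (W.conductorNorm ℤ)],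
      NonExceptionalRankOneAt W p → 5 ≤ p → Surj W p →
      ∀ (L : Type) [Field L] [NumberField L], IsImaginaryQuadratic L →
        SatisfiesHeegnerHypothesis (W.conductorNorm ℤ) L → SatisfiesHeegnerHypothesis p L →
        NumberField.discr L < -4 → Odd (NumberField.discr L) →
        (W.quadraticTwist (NumberField.discr L : ℚ)).entireLFunction 1 ≠ 0 →
      ∀ (Dt : ModularParametrizationData W (W.conductorNorm ℤ))
        (Hd : HeegnerDatum (W.conductorNorm ℤ) (NumberField.discr L)) (w₀ : NumberField.InfinitePlace L)
        (PL : (W.baseChange L).toAffine.Point),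
        WeierstrassCurve.Affine.Point.map w₀.embedding.toRatAlgHom PL = heegnerPointComplex Dt Hd →
        ¬ (p : ℤ) ∣ Dt.c →
      ∀ (s : ℚ) (k : ℤ),
        (Real.sqrt ((NumberField.discr L).natAbs : ℝ) : ℂ) *
            (W.quadraticTwist (NumberField.discr L : ℚ)).entireLFunction 1 = (s : ℂ) * (minusPeriod Dt.f : ℂ) →
        (Dt.c : ℝ) * minusPeriod Dt.f = k * W.imaginaryPeriodRat →
      ∀ (W' : WeierstrassCurve ℚ) [W'.IsElliptic] (D : ModularParametrizationData W' (W.conductorNorm ℤ)),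
        D.f = Dt.f →
        (∀ (W'' : WeierstrassCurve ℚ) [W''.IsElliptic] (D'' : ModularParametrizationData W'' (W.conductorNorm ℤ)),
            D''.f = D.f → D.modularDegree ≤ D''.modularDegree) →
      ∀ (K : ZpExtension ℚ p) (hK : K.IsCyclotomic) (γ : absoluteGaloisGroup ℚ)
        (I : IwasawaH1Data W p K γ), K.IsTopGenerator γ →
      ∀ (hp : p ≠ 2) (N : ℕ) [NeZero N] (f : CuspForm (Gamma0 N) 2), IsNewformOf W f →
      ∀ (ι : (n : ℕ) → (CyclotomicField n ℚ →+* ℂ)) (q : ℚ)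
        (Λ : ∀ (m : ℕ) (r : Finset (HeightOneSpectrum (𝓞 ℚ))),
          H1 (tateRep W p) (cycSubgroup p m r) →ₗ[ℤ_[p]] ℚ_[p] ⊗[ℚ] CyclotomicField (cycLevel p m r) ℚ)
        (c d₁ a : ℤ) (A : ℕ) (d' : ℤ)
        (z : ∀ (m : ℕ) (r : (cyclotomicLevelsRat p (badPlaces c d₁ A N)).Ideals),
          H1 (tateRep W p) ((cyclotomicLevelsRat p (badPlaces c d₁ A N)).level m r.1))
        (x : ∀ (m : ℕ) (r : (cyclotomicLevelsRat p (badPlaces c d₁ A N)).Ideals),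
          CyclotomicField (cycLevel p m r.1) ℚ)
        (y : I.H) (perRatio : ℚ),
        q ≠ 0 → ZetaBody W p f ι ((q : ℚ) : ℝ) Λ c d₁ a A z x →
        (∀ n : ℕ, I.proj n y =
          levelToLayer W p hK hp (badPlaces c d₁ A N) n
            (z (n + 1) (cyclotomicLevelsRat p (badPlaces c d₁ A N)).idealOne)) →
        0 < A → Int.gcd c (6 * p * A) = 1 → Int.gcd d₁ (6 * p * N) = 1 → (d₁ : ℤ) * d' ≡ 1 [ZMOD (A : ℤ)] →
        ratCuspFactor f true c d₁ a A d' ≠ 0 → perRatio ≠ 0 →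
        plusPeriod f = ((perRatio : ℚ) : ℝ) * W.realPeriodRat →
      ∀ (ι' : PadicAlgCl p ≃+* ℂ)
        (κ : ZpExtension L p) (γ' : absoluteGaloisGroup L) (ΩK : ℂ) (Ωp : (unrIntegers p)ˣ) (Λf : UnrSeries p),
        κ.IsAnticyclotomic → κ.IsTopGenerator γ' → ΩK ≠ 0 →
        IsBDPLFunction ι' (X11b.primeOfEmbeddingDatum p ι' w₀.embedding) κ γ' Dt.f ΩK
          ((Ωp : unrIntegers p) : ℂ_[p]) Λf →
      ∀ (X : ℂ_[p]), Λf.HasValueAt 0 X →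
      ∀ σ : ℚ_[p], HasLocPKummerLog W p (bottomClass W p K I y) σ → σ ≠ 0 →
        ‖X‖ = (p : ℝ) ^ (bdvExplicitExponent p (W.LFunction p) Dt.c s k (congruenceNumber Dt.f) D.modularDegree
            (σ.valuation + padicValRat p (perRatio /
              (q * ratCuspFactor f true c d₁ a A d' * ∏ ℓ ∈ A.primeFactors.erase p, eulerFactorAtOne W N ℓ))) -
            V p (NumberField.discr L))

/-- **S2 — `EisensteinPeriodRatioValuation L p` (the R2 atom): a CALIBRATOR exists at `(L, p)`.**  Some curve `E′`
over `ℚ` which is globally minimal, of analytic rank `1`, with `E′[p]` irreducible and `ρ̄_{E′,p}` surjective, GOOD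
ORDINARY at `p`, Heegner for `L` at its conductor, with `L(E′^{d_L},1) ≠ 0`, carries a full value-pinned data tuple
of the registered frame (Heegner datum and descent scalars, minimal parametrisation in the class of `f′`, a
value-pinned Kato family with its `IwasawaH1Data`, a BDP frame `IsBDPLFunction … Λf′` with value `X′` at the trivial
character, a Kummer logarithm `σ′ ≠ 0` of the bottom class) on which the crossing norm identity holds with exponent
`bdvExplicitExponent …` EXACTLY.  This pins BDV's `(K,p)`-constant `L(g)/log_p(u_p)` (rows 7–8 = R2; BSTW's `u_L`)
to valuation `0` in the explicit normalisation.  Finer split in §3: `CalibratorSupply L p` (conjecture-shaped) ∧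
`CalibratorDataRealisable` ∧ `BstwIntegralPerrinRiouGoodOrdinary` (print-shaped) ⟹ this.  Why it might fail: supply
(no printed theorem produces `E′` for a prescribed `L`; level-aspect non-vanishing is the expected road), and the
port's integrality at primes dividing `u_L` (BSTW (86): `u_L ∈ ℤ_(p)^×` needs their CM comparison, Thm. 6.6/6.7).
[cite: BurungaleSkinnerTianWan2024, Thm. 1.13 and §6.2.1 (86)–(94), p. 60]
[cite: BertoliniDarmonVenerucci2022, §4 (38) L13–15, p. 44] -/
def EisensteinPeriodRatioValuation (L : Type) [Field L] [NumberField L] (p : ℕ) [Fact p.Prime] : Prop :=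
  ∃ (W : WeierstrassCurve ℚ) (_ : W.IsElliptic) (_ : W.IsGloballyMinimal)
    (_ : ContinuousSMul ℤ_[p] (W.tateModule p)) (_ : Module.Free ℤ_[p] (W.tateModule p))
    (_ : Module.Finite ℤ_[p] (W.tateModule p)) (_ : NeZero (W.conductorNorm ℤ)),
    W.analyticRank = 1 ∧ Irr W p ∧ GoodOrd W p ∧ Surj W p ∧
    SatisfiesHeegnerHypothesis (W.conductorNorm ℤ) L ∧
    (W.quadraticTwist (NumberField.discr L : ℚ)).entireLFunction 1 ≠ 0 ∧
    ∃ (Dt : ModularParametrizationData W (W.conductorNorm ℤ))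
      (Hd : HeegnerDatum (W.conductorNorm ℤ) (NumberField.discr L)) (w₀ : NumberField.InfinitePlace L)
      (PL : (W.baseChange L).toAffine.Point),
      WeierstrassCurve.Affine.Point.map w₀.embedding.toRatAlgHom PL = heegnerPointComplex Dt Hd ∧
      ¬ (p : ℤ) ∣ Dt.c ∧
    ∃ (s : ℚ) (k : ℤ),
      (Real.sqrt ((NumberField.discr L).natAbs : ℝ) : ℂ) *
          (W.quadraticTwist (NumberField.discr L : ℚ)).entireLFunction 1 = (s : ℂ) * (minusPeriod Dt.f : ℂ) ∧
      (Dt.c : ℝ) * minusPeriod Dt.f = k * W.imaginaryPeriodRat ∧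
    ∃ (W' : WeierstrassCurve ℚ) (_ : W'.IsElliptic) (D : ModularParametrizationData W' (W.conductorNorm ℤ)),
      D.f = Dt.f ∧
      (∀ (W'' : WeierstrassCurve ℚ) [W''.IsElliptic] (D'' : ModularParametrizationData W'' (W.conductorNorm ℤ)),
          D''.f = D.f → D.modularDegree ≤ D''.modularDegree) ∧
    ∃ (K : ZpExtension ℚ p) (hK : K.IsCyclotomic) (γ : absoluteGaloisGroup ℚ)
      (I : IwasawaH1Data W p K γ), K.IsTopGenerator γ ∧
    ∃ (hp : p ≠ 2) (N : ℕ) (_ : NeZero N) (f : CuspForm (Gamma0 N) 2), IsNewformOf W f ∧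
    ∃ (ι : (n : ℕ) → (CyclotomicField n ℚ →+* ℂ)) (q : ℚ)
      (Λ : ∀ (m : ℕ) (r : Finset (HeightOneSpectrum (𝓞 ℚ))),
        H1 (tateRep W p) (cycSubgroup p m r) →ₗ[ℤ_[p]] ℚ_[p] ⊗[ℚ] CyclotomicField (cycLevel p m r) ℚ)
      (c d₁ a : ℤ) (A : ℕ) (d' : ℤ)
      (z : ∀ (m : ℕ) (r : (cyclotomicLevelsRat p (badPlaces c d₁ A N)).Ideals),
        H1 (tateRep W p) ((cyclotomicLevelsRat p (badPlaces c d₁ A N)).level m r.1))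
      (x : ∀ (m : ℕ) (r : (cyclotomicLevelsRat p (badPlaces c d₁ A N)).Ideals),
        CyclotomicField (cycLevel p m r.1) ℚ)
      (y : I.H) (perRatio : ℚ),
      q ≠ 0 ∧ ZetaBody W p f ι ((q : ℚ) : ℝ) Λ c d₁ a A z x ∧
      (∀ n : ℕ, I.proj n y =
        levelToLayer W p hK hp (badPlaces c d₁ A N) n
          (z (n + 1) (cyclotomicLevelsRat p (badPlaces c d₁ A N)).idealOne)) ∧
      0 < A ∧ Int.gcd c (6 * p * A) = 1 ∧ Int.gcd d₁ (6 * p * N) = 1 ∧ (d₁ : ℤ) * d' ≡ 1 [ZMOD (A : ℤ)] ∧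
      ratCuspFactor f true c d₁ a A d' ≠ 0 ∧ perRatio ≠ 0 ∧
      plusPeriod f = ((perRatio : ℚ) : ℝ) * W.realPeriodRat ∧
    ∃ (ι' : PadicAlgCl p ≃+* ℂ)
      (κ : ZpExtension L p) (γ' : absoluteGaloisGroup L) (ΩK : ℂ) (Ωp : (unrIntegers p)ˣ) (Λf : UnrSeries p),
      κ.IsAnticyclotomic ∧ κ.IsTopGenerator γ' ∧ ΩK ≠ 0 ∧
      IsBDPLFunction ι' (X11b.primeOfEmbeddingDatum p ι' w₀.embedding) κ γ' Dt.f ΩK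
        ((Ωp : unrIntegers p) : ℂ_[p]) Λf ∧
    ∃ (X : ℂ_[p]), Λf.HasValueAt 0 X ∧
    ∃ σ : ℚ_[p], HasLocPKummerLog W p (bottomClass W p K I y) σ ∧ σ ≠ 0 ∧
      ‖X‖ = (p : ℝ) ^ (bdvExplicitExponent p (W.LFunction p) Dt.c s k (congruenceNumber Dt.f) D.modularDegree
          (σ.valuation + padicValRat p (perRatio /
            (q * ratCuspFactor f true c d₁ a A d' * ∏ ℓ ∈ A.primeFactors.erase p, eulerFactorAtOne W N ℓ))))

/-- **The proved recomposition (deliverable 1, gate (i)).**  Conclusion = the statement of the registered open stub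
`BstwDoor.stub_katoBdpCrossingNonsplitFamily` (bstw_door.lean 5666110a8ff7d20b l.782–832) TOKEN FOR TOKEN.
Proof: S2 at `(L, p)` yields a calibrator with exact exponent `e′`; S1 at the calibrator yields exponent
`e′ − V p d_L` for the same norm; `p^· ` is injective (`p > 1`), so `V p d_L = 0`; S1 at the target curve (a member of
the class by `nonExceptionalRankOneAt_of_classX11b`) then gives the registered exponent once the `a_p`-term is
removed by `bdvExplicitExponent_of_not_split`. -/
theorem katoBdpCrossingNonsplitFamily_of_bdvChain_of_calibration
    (h₁ : BdvChainExplicitNonsplit)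
    (h₂ : ∀ (p : ℕ) [Fact p.Prime], 5 ≤ p → ∀ (L : Type) [Field L] [NumberField L],
      IsImaginaryQuadratic L → SatisfiesHeegnerHypothesis p L → NumberField.discr L < -4 →
      Odd (NumberField.discr L) → EisensteinPeriodRatioValuation L p) :
    ∀ (W : WeierstrassCurve ℚ) [W.IsElliptic] [W.IsGloballyMinimal] (p : ℕ) [Fact p.Prime]
      [ContinuousSMul ℤ_[p] (W.tateModule p)] [Module.Free ℤ_[p] (W.tateModule p)]
      [Module.Finite ℤ_[p] (W.tateModule p)] [NeZero (W.conductorNorm ℤ)],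
      ClassX11b W p → 5 ≤ p → Surj W p → ¬ W.HasSplitMultiplicativeReductionAtPrime p →
      ∀ (L : Type) [Field L] [NumberField L], IsImaginaryQuadratic L →
        SatisfiesHeegnerHypothesis (W.conductorNorm ℤ) L → SatisfiesHeegnerHypothesis p L →
        NumberField.discr L < -4 → Odd (NumberField.discr L) →
        (W.quadraticTwist (NumberField.discr L : ℚ)).entireLFunction 1 ≠ 0 →
      ∀ (Dt : ModularParametrizationData W (W.conductorNorm ℤ))
        (Hd : HeegnerDatum (W.conductorNorm ℤ) (NumberField.discr L)) (w₀ : NumberField.InfinitePlace L)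
        (PL : (W.baseChange L).toAffine.Point),
        WeierstrassCurve.Affine.Point.map w₀.embedding.toRatAlgHom PL = heegnerPointComplex Dt Hd →
        ¬ (p : ℤ) ∣ Dt.c →
      ∀ (s : ℚ) (k : ℤ),
        (Real.sqrt ((NumberField.discr L).natAbs : ℝ) : ℂ) *
            (W.quadraticTwist (NumberField.discr L : ℚ)).entireLFunction 1 = (s : ℂ) * (minusPeriod Dt.f : ℂ) →
        (Dt.c : ℝ) * minusPeriod Dt.f = k * W.imaginaryPeriodRat →
      ∀ (W' : WeierstrassCurve ℚ) [W'.IsElliptic] (D : ModularParametrizationData W' (W.conductorNorm ℤ)),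
        D.f = Dt.f →
        (∀ (W'' : WeierstrassCurve ℚ) [W''.IsElliptic] (D'' : ModularParametrizationData W'' (W.conductorNorm ℤ)),
            D''.f = D.f → D.modularDegree ≤ D''.modularDegree) →
      ∀ (K : ZpExtension ℚ p) (hK : K.IsCyclotomic) (γ : absoluteGaloisGroup ℚ)
        (I : IwasawaH1Data W p K γ), K.IsTopGenerator γ →
      ∀ (hp : p ≠ 2) (N : ℕ) [NeZero N] (f : CuspForm (Gamma0 N) 2), IsNewformOf W f →
      ∀ (ι : (n : ℕ) → (CyclotomicField n ℚ →+* ℂ)) (q : ℚ)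
        (Λ : ∀ (m : ℕ) (r : Finset (HeightOneSpectrum (𝓞 ℚ))),
          H1 (tateRep W p) (cycSubgroup p m r) →ₗ[ℤ_[p]] ℚ_[p] ⊗[ℚ] CyclotomicField (cycLevel p m r) ℚ)
        (c d₁ a : ℤ) (A : ℕ) (d' : ℤ)
        (z : ∀ (m : ℕ) (r : (cyclotomicLevelsRat p (badPlaces c d₁ A N)).Ideals),
          H1 (tateRep W p) ((cyclotomicLevelsRat p (badPlaces c d₁ A N)).level m r.1))
        (x : ∀ (m : ℕ) (r : (cyclotomicLevelsRat p (badPlaces c d₁ A N)).Ideals),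
          CyclotomicField (cycLevel p m r.1) ℚ)
        (y : I.H) (perRatio : ℚ),
        q ≠ 0 → ZetaBody W p f ι ((q : ℚ) : ℝ) Λ c d₁ a A z x →
        (∀ n : ℕ, I.proj n y =
          levelToLayer W p hK hp (badPlaces c d₁ A N) n
            (z (n + 1) (cyclotomicLevelsRat p (badPlaces c d₁ A N)).idealOne)) →
        0 < A → Int.gcd c (6 * p * A) = 1 → Int.gcd d₁ (6 * p * N) = 1 → (d₁ : ℤ) * d' ≡ 1 [ZMOD (A : ℤ)] →
        ratCuspFactor f true c d₁ a A d' ≠ 0 → perRatio ≠ 0 →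
        plusPeriod f = ((perRatio : ℚ) : ℝ) * W.realPeriodRat →
      ∀ (ι' : PadicAlgCl p ≃+* ℂ)
        (κ : ZpExtension L p) (γ' : absoluteGaloisGroup L) (ΩK : ℂ) (Ωp : (unrIntegers p)ˣ) (Λf : UnrSeries p),
        κ.IsAnticyclotomic → κ.IsTopGenerator γ' → ΩK ≠ 0 →
        IsBDPLFunction ι' (X11b.primeOfEmbeddingDatum p ι' w₀.embedding) κ γ' Dt.f ΩK
          ((Ωp : unrIntegers p) : ℂ_[p]) Λf →
      ∀ (X : ℂ_[p]), Λf.HasValueAt 0 X →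
      ∀ σ : ℚ_[p], HasLocPKummerLog W p (bottomClass W p K I y) σ → σ ≠ 0 →
        ‖X‖ = (p : ℝ) ^ (1 + padicValInt p Dt.c - padicValRat p s - padicValInt p k -
            ((padicValNat p (congruenceNumber Dt.f) : ℤ) - padicValNat p D.modularDegree) -
            (σ.valuation + padicValRat p (perRatio /
              (q * ratCuspFactor f true c d₁ a A d' * ∏ ℓ ∈ A.primeFactors.erase p, eulerFactorAtOne W N ℓ)))) := by
  intro W _ _ p _ _ _ _ _ hX h5 hS hns L _ _ hLq hH hHp hd4 hodd hLt Dt Hd w₀ PL hPL hc s k hs hk W' _ D hDf hmin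
    K hK γ I hγ hp N _ f hf ι q Λ c d₁ a A d' z x y perRatio hq hzeta hy hA hcg hd hdd' hR hper0 hper
    ι' κ γ' ΩK Ωp Λf hκ hγ' hΩK hBDP X hXv σ hσ hσ0
  obtain ⟨V, hV⟩ := h₁
  have hp1 : (1 : ℝ) < p := by exact_mod_cast (Fact.out : p.Prime).one_lt
  have hp0 : (0 : ℝ) < p := lt_trans one_pos hp1
  -- Step 1: the calibrator at `(L, p)` pins `V p d_L = 0`.
  have hV0 : V p (NumberField.discr L) = 0 := by
    obtain ⟨W₁, hE₁, hGM₁, hCS₁, hMF₁, hMFi₁, hNZ₁, hrk₁, hirr₁, hgo₁, hS₁, hH₁, hLt₁, Dt₁, Hd₁, w₁, PL₁, hPL₁,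
      hc₁, s₁, k₁, hs₁, hk₁, W₁', hE₁', D₁, hDf₁, hmin₁, K₁, hK₁, γ₁, I₁, hγ₁, hp₁, N₁, hN₁, f₁, hf₁, ι₁, q₁, Λ₁,
      c₁, e₁, a₁, A₁, e₁', z₁, x₁, y₁, perRatio₁, hq₁, hzeta₁, hy₁, hA₁, hcg₁, hd₁, hdd₁, hR₁, hper0₁, hper₁,
      ι₁', κ₁, γ₁', ΩK₁, Ωp₁, Λf₁, hκ₁, hγ₁', hΩK₁, hBDP₁, X₁, hXv₁, σ₁, hσ₁, hσ0₁, hnorm₁⟩ :=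
      h₂ p h5 L hLq hHp hd4 hodd
    have h := hV W₁ p ⟨hrk₁, hirr₁, Or.inr hgo₁⟩ h5 hS₁ L hLq hH₁ hHp hd4 hodd hLt₁ Dt₁ Hd₁ w₁ PL₁ hPL₁ hc₁
      s₁ k₁ hs₁ hk₁ W₁' D₁ hDf₁ hmin₁ K₁ hK₁ γ₁ I₁ hγ₁ hp₁ N₁ f₁ hf₁ ι₁ q₁ Λ₁ c₁ e₁ a₁ A₁ e₁' z₁ x₁ y₁
      perRatio₁ hq₁ hzeta₁ hy₁ hA₁ hcg₁ hd₁ hdd₁ hR₁ hper0₁ hper₁ ι₁' κ₁ γ₁' ΩK₁ Ωp₁ Λf₁ hκ₁ hγ₁' hΩK₁ hBDP₁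
      X₁ hXv₁ σ₁ hσ₁ hσ0₁
    rw [hnorm₁] at h
    have he := zpow_right_injective₀ hp0 hp1.ne' h
    omega
  -- Step 2: S1 at the target curve, with `V p d_L = 0` and `a_p = −1`.
  have h := hV W p (nonExceptionalRankOneAt_of_classX11b W p hX hns) h5 hS L hLq hH hHp hd4 hodd hLt Dt Hd w₀
    PL hPL hc s k hs hk W' D hDf hmin K hK γ I hγ hp N f hf ι q Λ c d₁ a A d' z x y perRatio hq hzeta hy hA hcg
    hd hdd' hR hper0 hper ι' κ γ' ΩK Ωp Λf hκ hγ' hΩK hBDP X hXv σ hσ hσ0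
  rw [hV0, sub_zero, bdvExplicitExponent_of_not_split W p hX.2.2.1 hns h5] at h
  exact h


/-! ## §3 The finer split of the calibrator atom — what is SUPPLY (conjecture-shaped) and what is PRINT

`EisensteinPeriodRatioValuation L p ⟸ CalibratorSupply L p ∧ CalibratorDataRealisable ∧ BstwIntegralPerrinRiouGoodOrdinary`
(`eisensteinPeriodRatioValuation_of_supply_of_port`, proved), so that the ER5 aside can be graded piecewise. -/

/-- **S2a — `CalibratorSupply L p` [conjecture-shaped obligation].**  For the admissible imaginary quadratic `L`
and the prime `p` there is an elliptic curve `E′/ℚ` (globally minimal model) of analytic rank `1`, with `E′[p]`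
irreducible and `ρ̄_{E′,p}` surjective, GOOD ORDINARY at `p`, satisfying the Heegner hypothesis for `L` at its
conductor, with `L(E′^{d_L}, 1) ≠ 0`.  No printed theorem supplies it for a PRESCRIBED `L` (road: level-aspect
non-vanishing of `L(E^{d_L},1)` over rank-one curves with prescribed local behaviour at `p` and at the primes of
`d_L`; BSTW choose `L` after `E`, §6.2.1 p. 60, which is the opposite order).  Why it might fail: it should not — it
is an existence statement about a Zariski-dense-looking family — but it is OPEN as stated.
[cite: BurungaleSkinnerTianWan2024, §6.2.1 «Let L be an imaginary quadratic field satisfying …», p. 60] -/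
def CalibratorSupply (L : Type) [Field L] [NumberField L] (p : ℕ) [Fact p.Prime] : Prop :=
  ∃ (W : WeierstrassCurve ℚ) (_ : W.IsElliptic) (_ : W.IsGloballyMinimal),
    W.analyticRank = 1 ∧ Irr W p ∧ GoodOrd W p ∧ Surj W p ∧
    SatisfiesHeegnerHypothesis (W.conductorNorm ℤ) L ∧
    (W.quadraticTwist (NumberField.discr L : ℚ)).entireLFunction 1 ≠ 0

/-- **S2c — `CalibratorDataRealisable` [print-shaped].**  Every good-ordinary rank-one big-image curve that is
Heegner for an admissible `L` (`p ≥ 5`) CARRIES a full data tuple of the registered frame with `σ ≠ 0`: a Heegner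
datum and an `L`-rational Heegner point over `heegnerPointComplex` [GrossZagier86 §I.6, V.2], the two descent scalars
[tree `ErratumRoadFiveGrossZagierDescentExact`], a minimal parametrisation in the class of `f`, the cyclotomic
`ℤ_p`-extension with `IwasawaH1Data` and a value-pinned Kato family dominating it [Kato04 Thm 12.5; tree
`Kato2004.AdmissibleZetaClassRealisability`], the period ratio, a BDP frame at the GOOD prime `p`
[BDP13 Thm 5.13; Castella–Hsieh 2018; tree `castella2018_exists_isBDPLFunction` (semistable case)], its value at the
trivial character, and a Kummer logarithm of the bottom class [tree `exists_hasLocPKummerLog_bottomClass`] which is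
NON-ZERO — the last clause is BSTW's Theorem 6.4 (`loc_p z_Kato ≠ 0` at a good ordinary prime of a rank-one curve).
Why it might fail: only through typed-literature gaps (the BDP frame at good `p` is in the tree for square-free `N`).
[cite: BurungaleSkinnerTianWan2024, Thm. 6.4, p. 59] [cite: Kato2004Asterisque, Thm. 12.5, p. 229] -/
def CalibratorDataRealisable : Prop :=
  ∀ (p : ℕ) [Fact p.Prime], 5 ≤ p → ∀ (L : Type) [Field L] [NumberField L], IsImaginaryQuadratic L →
    SatisfiesHeegnerHypothesis p L → NumberField.discr L < -4 → Odd (NumberField.discr L) →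
  ∀ (W : WeierstrassCurve ℚ) [W.IsElliptic] [W.IsGloballyMinimal],
    W.analyticRank = 1 → Irr W p → GoodOrd W p → Surj W p →
    SatisfiesHeegnerHypothesis (W.conductorNorm ℤ) L →
    (W.quadraticTwist (NumberField.discr L : ℚ)).entireLFunction 1 ≠ 0 →
  ∃ (_ : ContinuousSMul ℤ_[p] (W.tateModule p)) (_ : Module.Free ℤ_[p] (W.tateModule p))
    (_ : Module.Finite ℤ_[p] (W.tateModule p)) (_ : NeZero (W.conductorNorm ℤ)),
    ∃ (Dt : ModularParametrizationData W (W.conductorNorm ℤ))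
      (Hd : HeegnerDatum (W.conductorNorm ℤ) (NumberField.discr L)) (w₀ : NumberField.InfinitePlace L)
      (PL : (W.baseChange L).toAffine.Point),
      WeierstrassCurve.Affine.Point.map w₀.embedding.toRatAlgHom PL = heegnerPointComplex Dt Hd ∧
      ¬ (p : ℤ) ∣ Dt.c ∧
    ∃ (s : ℚ) (k : ℤ),
      (Real.sqrt ((NumberField.discr L).natAbs : ℝ) : ℂ) *
          (W.quadraticTwist (NumberField.discr L : ℚ)).entireLFunction 1 = (s : ℂ) * (minusPeriod Dt.f : ℂ) ∧
      (Dt.c : ℝ) * minusPeriod Dt.f = k * W.imaginaryPeriodRat ∧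
    ∃ (W' : WeierstrassCurve ℚ) (_ : W'.IsElliptic) (D : ModularParametrizationData W' (W.conductorNorm ℤ)),
      D.f = Dt.f ∧
      (∀ (W'' : WeierstrassCurve ℚ) [W''.IsElliptic] (D'' : ModularParametrizationData W'' (W.conductorNorm ℤ)),
          D''.f = D.f → D.modularDegree ≤ D''.modularDegree) ∧
    ∃ (K : ZpExtension ℚ p) (hK : K.IsCyclotomic) (γ : absoluteGaloisGroup ℚ)
      (I : IwasawaH1Data W p K γ), K.IsTopGenerator γ ∧
    ∃ (hp : p ≠ 2) (N : ℕ) (_ : NeZero N) (f : CuspForm (Gamma0 N) 2), IsNewformOf W f ∧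
    ∃ (ι : (n : ℕ) → (CyclotomicField n ℚ →+* ℂ)) (q : ℚ)
      (Λ : ∀ (m : ℕ) (r : Finset (HeightOneSpectrum (𝓞 ℚ))),
        H1 (tateRep W p) (cycSubgroup p m r) →ₗ[ℤ_[p]] ℚ_[p] ⊗[ℚ] CyclotomicField (cycLevel p m r) ℚ)
      (c d₁ a : ℤ) (A : ℕ) (d' : ℤ)
      (z : ∀ (m : ℕ) (r : (cyclotomicLevelsRat p (badPlaces c d₁ A N)).Ideals),
        H1 (tateRep W p) ((cyclotomicLevelsRat p (badPlaces c d₁ A N)).level m r.1))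
      (x : ∀ (m : ℕ) (r : (cyclotomicLevelsRat p (badPlaces c d₁ A N)).Ideals),
        CyclotomicField (cycLevel p m r.1) ℚ)
      (y : I.H) (perRatio : ℚ),
      q ≠ 0 ∧ ZetaBody W p f ι ((q : ℚ) : ℝ) Λ c d₁ a A z x ∧
      (∀ n : ℕ, I.proj n y =
        levelToLayer W p hK hp (badPlaces c d₁ A N) n
          (z (n + 1) (cyclotomicLevelsRat p (badPlaces c d₁ A N)).idealOne)) ∧
      0 < A ∧ Int.gcd c (6 * p * A) = 1 ∧ Int.gcd d₁ (6 * p * N) = 1 ∧ (d₁ : ℤ) * d' ≡ 1 [ZMOD (A : ℤ)] ∧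
      ratCuspFactor f true c d₁ a A d' ≠ 0 ∧ perRatio ≠ 0 ∧
      plusPeriod f = ((perRatio : ℚ) : ℝ) * W.realPeriodRat ∧
    ∃ (ι' : PadicAlgCl p ≃+* ℂ)
      (κ : ZpExtension L p) (γ' : absoluteGaloisGroup L) (ΩK : ℂ) (Ωp : (unrIntegers p)ˣ) (Λf : UnrSeries p),
      κ.IsAnticyclotomic ∧ κ.IsTopGenerator γ' ∧ ΩK ≠ 0 ∧
      IsBDPLFunction ι' (X11b.primeOfEmbeddingDatum p ι' w₀.embedding) κ γ' Dt.f ΩK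
        ((Ωp : unrIntegers p) : ℂ_[p]) Λf ∧
    ∃ (X : ℂ_[p]), Λf.HasValueAt 0 X ∧
    ∃ σ : ℚ_[p], HasLocPKummerLog W p (bottomClass W p K I y) σ ∧ σ ≠ 0

/-- **S2b — `BstwIntegralPerrinRiouGoodOrdinary` [print-shaped port; the typed-literature gap named in
`Literature/NumberTheory/EllipticCurves/BurungaleSkinnerTianWan2024/IntroductionTheoremsOPEN.lean` (Thm 1.13 not
typed)].**  For every GOOD ORDINARY rank-one big-image curve (`p ≥ 5`), every admissible `L` and every value-pinned
data tuple of the registered frame, `σ ≠ 0 →` the crossing norm identity holds with the explicit exponent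
`bdvExplicitExponent …` EXACTLY: Burungale–Skinner–Tian–Wan's integral Perrin-Riou formula (log-Kato-elt-1) with
`u_L ∈ ℤ_(p)^×` ((86)–(94)) and `c(ω,γ,γ′) ∈ O^×` (Prop. 4.13 (ii)), crossed with the BDP value formula at a good prime
(`(1 − a_p/p + 1/p)²`, `bdpInterpolationValue` with `ε_p = p⁻¹`) and the Gross–Zagier descent, in the LEAD's
Kato-family currency (rows 1–2 as on the door).  It is the good-`p` twin of `A♭-fam`.  Why it might fail: the ONE
transcription risk flagged in the module docstring (`Γ₀` vs a `p`-stabilised congruence number at good `p`).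
[cite: BurungaleSkinnerTianWan2024, Thm. 1.13, Prop. 4.13, §6.2.1 (86)–(94), p. 43, 59–60]
[cite: Kato2004Asterisque, Thm. 12.5 (1), p. 229] -/
def BstwIntegralPerrinRiouGoodOrdinary : Prop :=
  ∀ (W : WeierstrassCurve ℚ) [W.IsElliptic] [W.IsGloballyMinimal] (p : ℕ) [Fact p.Prime]
    [ContinuousSMul ℤ_[p] (W.tateModule p)] [Module.Free ℤ_[p] (W.tateModule p)]
    [Module.Finite ℤ_[p] (W.tateModule p)] [NeZero (W.conductorNorm ℤ)],
    W.analyticRank = 1 → Irr W p → GoodOrd W p → 5 ≤ p → Surj W p →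
    ∀ (L : Type) [Field L] [NumberField L], IsImaginaryQuadratic L →
      SatisfiesHeegnerHypothesis (W.conductorNorm ℤ) L → SatisfiesHeegnerHypothesis p L →
      NumberField.discr L < -4 → Odd (NumberField.discr L) →
      (W.quadraticTwist (NumberField.discr L : ℚ)).entireLFunction 1 ≠ 0 →
      ∀ (Dt : ModularParametrizationData W (W.conductorNorm ℤ))
        (Hd : HeegnerDatum (W.conductorNorm ℤ) (NumberField.discr L)) (w₀ : NumberField.InfinitePlace L)
        (PL : (W.baseChange L).toAffine.Point),
        WeierstrassCurve.Affine.Point.map w₀.embedding.toRatAlgHom PL = heegnerPointComplex Dt Hd →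
        ¬ (p : ℤ) ∣ Dt.c →
      ∀ (s : ℚ) (k : ℤ),
        (Real.sqrt ((NumberField.discr L).natAbs : ℝ) : ℂ) *
            (W.quadraticTwist (NumberField.discr L : ℚ)).entireLFunction 1 = (s : ℂ) * (minusPeriod Dt.f : ℂ) →
        (Dt.c : ℝ) * minusPeriod Dt.f = k * W.imaginaryPeriodRat →
      ∀ (W' : WeierstrassCurve ℚ) [W'.IsElliptic] (D : ModularParametrizationData W' (W.conductorNorm ℤ)),
        D.f = Dt.f →
        (∀ (W'' : WeierstrassCurve ℚ) [W''.IsElliptic] (D'' : ModularParametrizationData W'' (W.conductorNorm ℤ)),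
            D''.f = D.f → D.modularDegree ≤ D''.modularDegree) →
      ∀ (K : ZpExtension ℚ p) (hK : K.IsCyclotomic) (γ : absoluteGaloisGroup ℚ)
        (I : IwasawaH1Data W p K γ), K.IsTopGenerator γ →
      ∀ (hp : p ≠ 2) (N : ℕ) [NeZero N] (f : CuspForm (Gamma0 N) 2), IsNewformOf W f →
      ∀ (ι : (n : ℕ) → (CyclotomicField n ℚ →+* ℂ)) (q : ℚ)
        (Λ : ∀ (m : ℕ) (r : Finset (HeightOneSpectrum (𝓞 ℚ))),
          H1 (tateRep W p) (cycSubgroup p m r) →ₗ[ℤ_[p]] ℚ_[p] ⊗[ℚ] CyclotomicField (cycLevel p m r) ℚ)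
        (c d₁ a : ℤ) (A : ℕ) (d' : ℤ)
        (z : ∀ (m : ℕ) (r : (cyclotomicLevelsRat p (badPlaces c d₁ A N)).Ideals),
          H1 (tateRep W p) ((cyclotomicLevelsRat p (badPlaces c d₁ A N)).level m r.1))
        (x : ∀ (m : ℕ) (r : (cyclotomicLevelsRat p (badPlaces c d₁ A N)).Ideals),
          CyclotomicField (cycLevel p m r.1) ℚ)
        (y : I.H) (perRatio : ℚ),
        q ≠ 0 → ZetaBody W p f ι ((q : ℚ) : ℝ) Λ c d₁ a A z x →
        (∀ n : ℕ, I.proj n y =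
          levelToLayer W p hK hp (badPlaces c d₁ A N) n
            (z (n + 1) (cyclotomicLevelsRat p (badPlaces c d₁ A N)).idealOne)) →
        0 < A → Int.gcd c (6 * p * A) = 1 → Int.gcd d₁ (6 * p * N) = 1 → (d₁ : ℤ) * d' ≡ 1 [ZMOD (A : ℤ)] →
        ratCuspFactor f true c d₁ a A d' ≠ 0 → perRatio ≠ 0 →
        plusPeriod f = ((perRatio : ℚ) : ℝ) * W.realPeriodRat →
      ∀ (ι' : PadicAlgCl p ≃+* ℂ)
        (κ : ZpExtension L p) (γ' : absoluteGaloisGroup L) (ΩK : ℂ) (Ωp : (unrIntegers p)ˣ) (Λf : UnrSeries p),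
        κ.IsAnticyclotomic → κ.IsTopGenerator γ' → ΩK ≠ 0 →
        IsBDPLFunction ι' (X11b.primeOfEmbeddingDatum p ι' w₀.embedding) κ γ' Dt.f ΩK
          ((Ωp : unrIntegers p) : ℂ_[p]) Λf →
      ∀ (X : ℂ_[p]), Λf.HasValueAt 0 X →
      ∀ σ : ℚ_[p], HasLocPKummerLog W p (bottomClass W p K I y) σ → σ ≠ 0 →
        ‖X‖ = (p : ℝ) ^ (bdvExplicitExponent p (W.LFunction p) Dt.c s k (congruenceNumber Dt.f) D.modularDegree
            (σ.valuation + padicValRat p (perRatio /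
              (q * ratCuspFactor f true c d₁ a A d' * ∏ ℓ ∈ A.primeFactors.erase p, eulerFactorAtOne W N ℓ))))

/-- Recomposition of the calibrator atom from its three pieces (proved). -/
theorem eisensteinPeriodRatioValuation_of_supply_of_port (p : ℕ) [Fact p.Prime] (h5 : 5 ≤ p) (L : Type)
    [Field L] [NumberField L] (hLq : IsImaginaryQuadratic L) (hHp : SatisfiesHeegnerHypothesis p L)
    (hd4 : NumberField.discr L < -4) (hodd : Odd (NumberField.discr L)) (hsup : CalibratorSupply L p)
    (hreal : CalibratorDataRealisable) (hport : BstwIntegralPerrinRiouGoodOrdinary) :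
    EisensteinPeriodRatioValuation L p := by
  obtain ⟨W, hE, hGM, hrk, hirr, hgo, hS, hH, hLt⟩ := hsup
  obtain ⟨hCS, hMF, hMFi, hNZ, Dt, Hd, w₀, PL, hPL, hc, s, k, hs, hk, W', hE', D, hDf, hmin, K, hK, γ, I, hγ, hp,
    N, hN, f, hf, ι, q, Λ, c, d₁, a, A, d', z, x, y, perRatio, hq, hzeta, hy, hA, hcg, hd, hdd, hR, hper0, hper,
    ι', κ, γ', ΩK, Ωp, Λf, hκ, hγ', hΩK, hBDP, X, hXv, σ, hσ, hσ0⟩ :=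
    hreal p h5 L hLq hHp hd4 hodd W hrk hirr hgo hS hH hLt
  exact ⟨W, hE, hGM, hCS, hMF, hMFi, hNZ, hrk, hirr, hgo, hS, hH, hLt, Dt, Hd, w₀, PL, hPL, hc, s, k, hs, hk, W',
    hE', D, hDf, hmin, K, hK, γ, I, hγ, hp, N, hN, f, hf, ι, q, Λ, c, d₁, a, A, d', z, x, y, perRatio, hq, hzeta,
    hy, hA, hcg, hd, hdd, hR, hper0, hper, ι', κ, γ', ΩK, Ωp, Λf, hκ, hγ', hΩK, hBDP, X, hXv, σ, hσ, hσ0,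
    hport W p hrk hirr hgo h5 hS L hLq hH hHp hd4 hodd hLt Dt Hd w₀ PL hPL hc s k hs hk W' D hDf hmin K hK γ I hγ
      hp N f hf ι q Λ c d₁ a A d' z x y perRatio hq hzeta hy hA hcg hd hdd hR hper0 hper ι' κ γ' ΩK Ωp Λf hκ hγ'
      hΩK hBDP X hXv σ hσ hσ0⟩

/-! ## §4 Certificates: the registered statement as a named `Prop`, the three-piece corollary, and `S1 ⟸ A♭-fam ∧ S2b` -/

/-- The registered open stub statement `BstwDoor.stub_katoBdpCrossingNonsplitFamily` (= `A♭-fam`) as a named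
`Prop` — body = bstw_door.lean (5666110a8ff7d20b) l.782–832 verbatim (same 51 lines as the conclusion of
`katoBdpCrossingNonsplitFamily_of_bdvChain_of_calibration`; sha16 of the block `3df97ba8f0964633`).
[cite: Kato2004Asterisque, Thm. 12.5, p. 229] [cite: BurungaleSkinnerTianWan2024, Thm. 1.1, p. 3] -/
def AFlatFamStatement : Prop :=
    ∀ (W : WeierstrassCurve ℚ) [W.IsElliptic] [W.IsGloballyMinimal] (p : ℕ) [Fact p.Prime]
      [ContinuousSMul ℤ_[p] (W.tateModule p)] [Module.Free ℤ_[p] (W.tateModule p)]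
      [Module.Finite ℤ_[p] (W.tateModule p)] [NeZero (W.conductorNorm ℤ)],
      ClassX11b W p → 5 ≤ p → Surj W p → ¬ W.HasSplitMultiplicativeReductionAtPrime p →
      ∀ (L : Type) [Field L] [NumberField L], IsImaginaryQuadratic L →
        SatisfiesHeegnerHypothesis (W.conductorNorm ℤ) L → SatisfiesHeegnerHypothesis p L →
        NumberField.discr L < -4 → Odd (NumberField.discr L) →
        (W.quadraticTwist (NumberField.discr L : ℚ)).entireLFunction 1 ≠ 0 →
      ∀ (Dt : ModularParametrizationData W (W.conductorNorm ℤ))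
        (Hd : HeegnerDatum (W.conductorNorm ℤ) (NumberField.discr L)) (w₀ : NumberField.InfinitePlace L)
        (PL : (W.baseChange L).toAffine.Point),
        WeierstrassCurve.Affine.Point.map w₀.embedding.toRatAlgHom PL = heegnerPointComplex Dt Hd →
        ¬ (p : ℤ) ∣ Dt.c →
      ∀ (s : ℚ) (k : ℤ),
        (Real.sqrt ((NumberField.discr L).natAbs : ℝ) : ℂ) *
            (W.quadraticTwist (NumberField.discr L : ℚ)).entireLFunction 1 = (s : ℂ) * (minusPeriod Dt.f : ℂ) →
        (Dt.c : ℝ) * minusPeriod Dt.f = k * W.imaginaryPeriodRat →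
      ∀ (W' : WeierstrassCurve ℚ) [W'.IsElliptic] (D : ModularParametrizationData W' (W.conductorNorm ℤ)),
        D.f = Dt.f →
        (∀ (W'' : WeierstrassCurve ℚ) [W''.IsElliptic] (D'' : ModularParametrizationData W'' (W.conductorNorm ℤ)),
            D''.f = D.f → D.modularDegree ≤ D''.modularDegree) →
      ∀ (K : ZpExtension ℚ p) (hK : K.IsCyclotomic) (γ : absoluteGaloisGroup ℚ)
        (I : IwasawaH1Data W p K γ), K.IsTopGenerator γ →
      ∀ (hp : p ≠ 2) (N : ℕ) [NeZero N] (f : CuspForm (Gamma0 N) 2), IsNewformOf W f →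
      ∀ (ι : (n : ℕ) → (CyclotomicField n ℚ →+* ℂ)) (q : ℚ)
        (Λ : ∀ (m : ℕ) (r : Finset (HeightOneSpectrum (𝓞 ℚ))),
          H1 (tateRep W p) (cycSubgroup p m r) →ₗ[ℤ_[p]] ℚ_[p] ⊗[ℚ] CyclotomicField (cycLevel p m r) ℚ)
        (c d₁ a : ℤ) (A : ℕ) (d' : ℤ)
        (z : ∀ (m : ℕ) (r : (cyclotomicLevelsRat p (badPlaces c d₁ A N)).Ideals),
          H1 (tateRep W p) ((cyclotomicLevelsRat p (badPlaces c d₁ A N)).level m r.1))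
        (x : ∀ (m : ℕ) (r : (cyclotomicLevelsRat p (badPlaces c d₁ A N)).Ideals),
          CyclotomicField (cycLevel p m r.1) ℚ)
        (y : I.H) (perRatio : ℚ),
        q ≠ 0 → ZetaBody W p f ι ((q : ℚ) : ℝ) Λ c d₁ a A z x →
        (∀ n : ℕ, I.proj n y =
          levelToLayer W p hK hp (badPlaces c d₁ A N) n
            (z (n + 1) (cyclotomicLevelsRat p (badPlaces c d₁ A N)).idealOne)) →
        0 < A → Int.gcd c (6 * p * A) = 1 → Int.gcd d₁ (6 * p * N) = 1 → (d₁ : ℤ) * d' ≡ 1 [ZMOD (A : ℤ)] →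
        ratCuspFactor f true c d₁ a A d' ≠ 0 → perRatio ≠ 0 →
        plusPeriod f = ((perRatio : ℚ) : ℝ) * W.realPeriodRat →
      ∀ (ι' : PadicAlgCl p ≃+* ℂ)
        (κ : ZpExtension L p) (γ' : absoluteGaloisGroup L) (ΩK : ℂ) (Ωp : (unrIntegers p)ˣ) (Λf : UnrSeries p),
        κ.IsAnticyclotomic → κ.IsTopGenerator γ' → ΩK ≠ 0 →
        IsBDPLFunction ι' (X11b.primeOfEmbeddingDatum p ι' w₀.embedding) κ γ' Dt.f ΩK
          ((Ωp : unrIntegers p) : ℂ_[p]) Λf →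
      ∀ (X : ℂ_[p]), Λf.HasValueAt 0 X →
      ∀ σ : ℚ_[p], HasLocPKummerLog W p (bottomClass W p K I y) σ → σ ≠ 0 →
        ‖X‖ = (p : ℝ) ^ (1 + padicValInt p Dt.c - padicValRat p s - padicValInt p k -
            ((padicValNat p (congruenceNumber Dt.f) : ℤ) - padicValNat p D.modularDegree) -
            (σ.valuation + padicValRat p (perRatio /
              (q * ratCuspFactor f true c d₁ a A d' * ∏ ℓ ∈ A.primeFactors.erase p, eulerFactorAtOne W N ℓ))))

theorem aFlatFam_of_bdvChain_of_calibration (h₁ : BdvChainExplicitNonsplit)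
    (h₂ : ∀ (p : ℕ) [Fact p.Prime], 5 ≤ p → ∀ (L : Type) [Field L] [NumberField L],
      IsImaginaryQuadratic L → SatisfiesHeegnerHypothesis p L → NumberField.discr L < -4 →
      Odd (NumberField.discr L) → EisensteinPeriodRatioValuation L p) :
    AFlatFamStatement := by
  unfold AFlatFamStatement
  exact katoBdpCrossingNonsplitFamily_of_bdvChain_of_calibration h₁ h₂

/-- The three-piece corollary: S1 ∧ (supply at every admissible `(L,p)`) ∧ S2c ∧ S2b ⟹ `A♭-fam`. -/
theorem aFlatFam_of_bdvChain_of_supply_of_port (h₁ : BdvChainExplicitNonsplit)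
    (hsup : ∀ (p : ℕ) [Fact p.Prime], 5 ≤ p → ∀ (L : Type) [Field L] [NumberField L],
      IsImaginaryQuadratic L → SatisfiesHeegnerHypothesis p L → NumberField.discr L < -4 →
      Odd (NumberField.discr L) → CalibratorSupply L p)
    (hreal : CalibratorDataRealisable) (hport : BstwIntegralPerrinRiouGoodOrdinary) : AFlatFamStatement :=
  aFlatFam_of_bdvChain_of_calibration h₁ (fun p _ h5 L _ _ hLq hHp hd4 hodd =>
    eisensteinPeriodRatioValuation_of_supply_of_port p h5 L hLq hHp hd4 hodd (hsup p h5 L hLq hHp hd4 hodd)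
      hreal hport)

/-- Anti-costume certificate, one direction: S1 is IMPLIED by `A♭-fam ∧ S2b` (take `V = 0`).  (It implies neither:
S1 alone fixes no value of `V`.) -/
theorem bdvChainExplicitNonsplit_of_aFlatFam_of_port (hA : AFlatFamStatement)
    (hport : BstwIntegralPerrinRiouGoodOrdinary) : BdvChainExplicitNonsplit := by
  refine ⟨fun _ _ => 0, ?_⟩
  intro W _ _ p _ _ _ _ _ hcls h5 hS L _ _ hLq hH hHp hd4 hodd hLt Dt Hd w₀ PL hPL hc s k hs hk W' _ D hDf hmin
    K hK γ I hγ hp N _ f hf ι q Λ c d₁ a A d' z x y perRatio hq hzeta hy hA0 hcg hd hdd' hR hper0 hper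
    ι' κ γ' ΩK Ωp Λf hκ hγ' hΩK hBDP X hXv σ hσ hσ0
  simp only [sub_zero]
  rcases hcls with ⟨hrk, hirr, hmult | hgo⟩
  · have hp2 : p ≠ 2 := by omega
    have h := hA W p ⟨hrk, hp2, hmult.1, hirr⟩ h5 hS hmult.2 L hLq hH hHp hd4 hodd hLt Dt Hd w₀ PL hPL hc s k
      hs hk W' D hDf hmin K hK γ I hγ hp N f hf ι q Λ c d₁ a A d' z x y perRatio hq hzeta hy hA0 hcg hd hdd' hR
      hper0 hper ι' κ γ' ΩK Ωp Λf hκ hγ' hΩK hBDP X hXv σ hσ hσ0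
    rw [bdvExplicitExponent_of_not_split W p hmult.1 hmult.2 h5]
    exact h
  · exact hport W p hrk hirr hgo h5 hS L hLq hH hHp hd4 hodd hLt Dt Hd w₀ PL hPL hc s k hs hk W' D hDf hmin K
      hK γ I hγ hp N f hf ι q Λ c d₁ a A d' z x y perRatio hq hzeta hy hA0 hcg hd hdd' hR hper0 hper ι' κ γ' ΩK
      Ωp Λf hκ hγ' hΩK hBDP X hXv σ hσ hσ0

end Summit.BirchSwinnertonDyer.BirchSwinnertonDyer.Cruxes.EulerHalfNotRamNoInertSetAtFive.BdvCalibrationSplit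

end
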